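import Summits.QuantumFields.YangMills.Theorems.BalabanLadderUVSeamRecCeilingsWindowCellLaws
import HarnessLib

/-!
# Crux `UVSeamRec` (stmt-QuantumFields-20043), v5(α) stub `stub_responseMomentsOdd6` (RM): the level-`0` hypothesis of the window-cell-law button
# discharged from a threshold floor `ε(β,0) ≥ ε₀ > 0` — the final lane-B form of the (β) press-button

Helper file (`--supports stmt-QuantumFields-20043`) of the width-lever seat `ym-20043-ceilings-p2` (lane B, gen 3); a corollary of this seat's
`…CeilingsWindowCellLaws` (p554392).  The button `responseMoments_of_quadratic_and_windowCellLaws` asks, besides (split), (EM_Q) and the window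
cell laws at the levels `k ≥ 1`, that the PROVED level-`0` activity `exp(−βNε(β,0)/#Orient + (K₀ + D₁ log β)/#Orient)` (#Orient = 6, constants of
ceilings-p2 g0's p530009) be eventually `≤ Δ₀` for every `K₀, D₁`.  §1 proves this for ANY `Δ₀ > 0` as soon as the level-`0` thresholds are bounded
below, `ε(β,0) ≥ ε₀ > 0` (`log β ≤ cβ − 1 − log c`): `levelZero_activity_eventually_le`.  §2 restates the button and its registered-stub twin with
the hypotheses `0 < ε₀`, `ε₀ ≤ ε β 0`, `0 < Δ₀` in place of the eventual bound: `responseMoments_of_quadratic_and_windowCellLaws_floor`,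
`responseMomentsOdd6_of_quadratic_and_windowCellLaws_floor` — conclusion `B = A₀ + max(B_Q, 2e²·1536·(Δ₀ + D))` for any `Δ₀ > 0`.
So the located residual of (S-A) along (β), by name, is exactly: (split), (EM_Q), and the WINDOW CELL LAWS at the levels `k ≥ 1` with
`Σ_{1≤k≤kmax β R} δ(β,k)^{1/16} ≤ D` (`θ = δ^{1/16}`).  HONEST FRAMING: composition + one limit; nothing of E0′; not a gap, not Clay.
References: folklore.
-/

set_option autoImplicit false

noncomputable section

open MeasureTheory Filter Topology Finset
open Literature.Probability.LatticeModels
open Literature.MathematicalPhysics.QuantumFieldTheory (GaugeConfig LatticeRep)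
open Literature.MathematicalPhysics.QuantumLattice

namespace Summit.QuantumFields.YangMills.Cruxes.UVSeamRec.TemperedResponse

open Summit.QuantumFields.YangMills.Cruxes.OSLegsFromFemtoAndGap.DlrCollarTransfer
open Summit.QuantumFields.YangMills.Cruxes.UVSeamRec.PolymerData
open Summit.QuantumFields.YangMills.Theorems.OddTorusChessboard (Orient)

/-! ## §1 The level-`0` activity tends to zero under a threshold floor -/

section Activity

/-- **The level-`0` activity is eventually small.**  For `N > 0`, a threshold floor `ε(β,0) ≥ ε₀ > 0`, any target `Δ₀ > 0` and any constants
`K₀, D₁`: for all large `β`, `exp(−βNε(β,0)/#Orient + (K₀ + D₁ log β)/#Orient) ≤ Δ₀` (`#Orient > 0`; `log β ≤ cβ − 1 − log c` with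
`c = Nε₀/(2(D₁+1))`). [folklore] -/
theorem levelZero_activity_eventually_le {N : ℕ} (hN : 0 < N) {ε₀ Δ₀ : ℝ} (hε₀ : 0 < ε₀) (hΔ₀ : 0 < Δ₀) (ε : ℝ → ℕ → ℝ)
    (hε : ∀ β, ε₀ ≤ ε β 0) (K₀ : ℝ) (D₁ : ℕ) :
    ∃ β₀ : ℝ, ∀ β : ℝ, β₀ ≤ β →
      Real.exp (-(β * ((N : ℝ) * ε β 0)) / Fintype.card (Orient 4) + (K₀ + D₁ * Real.log β) / Fintype.card (Orient 4)) ≤ Δ₀ := by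
  have hN' : (0 : ℝ) < N := by exact_mod_cast hN
  have hcard : (0 : ℝ) < Fintype.card (Orient 4) := by
    have : Fintype.card (Orient 4) = 6 := by decide
    rw [this]; norm_num
  set c : ℝ := (N : ℝ) * ε₀ / (2 * ((D₁ : ℝ) + 1)) with hc
  have hcpos : 0 < c := by rw [hc]; positivity
  -- `M` bounds `K₀ + D₁ log β + βNε₀/2` from above ... precisely: `K₀ + D₁ log β ≤ βNε₀/2 + M`
  set M : ℝ := K₀ - (D₁ : ℝ) * (1 + Real.log c) with hM
  set β₀ : ℝ := max 1 (2 * (M - Fintype.card (Orient 4) * Real.log Δ₀) / ((N : ℝ) * ε₀)) with hβ₀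
  refine ⟨β₀, fun β hβ => ?_⟩
  have hβ1 : 1 ≤ β := (le_max_left _ _).trans hβ
  have hβ0 : 0 < β := by linarith
  have hlog : Real.log β ≤ β * c - 1 - Real.log c := by
    have h2 := Real.log_le_sub_one_of_pos (mul_pos hβ0 hcpos)
    rw [Real.log_mul hβ0.ne' hcpos.ne'] at h2
    linarith
  have hD : (0 : ℝ) ≤ D₁ := Nat.cast_nonneg _
  have h3 : (D₁ : ℝ) * Real.log β ≤ D₁ * (β * c - 1 - Real.log c) := mul_le_mul_of_nonneg_left hlog hD
  have h4 : (D₁ : ℝ) * (β * c) ≤ β * (N * ε₀) / 2 := by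
    rw [hc]
    have : (D₁ : ℝ) * (β * (N * ε₀ / (2 * (D₁ + 1)))) = β * (N * ε₀) / 2 * (D₁ / (D₁ + 1)) := by
      field_simp
    rw [this]
    have h5 : (D₁ : ℝ) / (D₁ + 1) ≤ 1 := by rw [div_le_one (by positivity)]; linarith
    have h6 : 0 ≤ β * (N * ε₀) / 2 := by positivity
    nlinarith
  have hnum : -(β * ((N : ℝ) * ε β 0)) + (K₀ + D₁ * Real.log β) ≤ -(β * (N * ε₀)) / 2 + M := by
    have h1 : β * (N * ε₀) ≤ β * (N * ε β 0) :=
      mul_le_mul_of_nonneg_left (mul_le_mul_of_nonneg_left (hε β) hN'.le) hβ0.le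
    rw [hM]
    nlinarith
  -- the largeness of β makes the exponent ≤ log Δ₀ · #Orient
  have hβlarge : 2 * (M - Fintype.card (Orient 4) * Real.log Δ₀) / ((N : ℝ) * ε₀) ≤ β := (le_max_right _ _).trans hβ
  have hNε : 0 < (N : ℝ) * ε₀ := by positivity
  have hβlarge' : 2 * (M - Fintype.card (Orient 4) * Real.log Δ₀) ≤ β * ((N : ℝ) * ε₀) := by
    rw [div_le_iff₀ hNε] at hβlarge
    linarith
  have hexp_le : (-(β * ((N : ℝ) * ε β 0)) / Fintype.card (Orient 4) + (K₀ + D₁ * Real.log β) / Fintype.card (Orient 4)) ≤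
      Real.log Δ₀ := by
    rw [← add_div, div_le_iff₀ hcard]
    nlinarith
  calc Real.exp (-(β * ((N : ℝ) * ε β 0)) / Fintype.card (Orient 4) + (K₀ + D₁ * Real.log β) / Fintype.card (Orient 4))
      ≤ Real.exp (Real.log Δ₀) := Real.exp_le_exp.2 hexp_le
    _ = Δ₀ := Real.exp_log hΔ₀

end Activity

/-! ## §2 The window-cell-law button with a threshold floor at level `0` -/

section Floor

variable {N : ℕ} [NeZero N]

/-- **(RM) FROM THE (β) SPLIT, (EM_Q) AND WINDOW CELL LAWS — threshold floor at level `0`.**  As `responseMoments_of_quadratic_and_windowCellLaws`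
(fundamental representation of `SU(N)`, any unit), with the eventual bound of the level-`0` activity REPLACED by `0 < ε₀ ≤ ε(β,0)` and an arbitrary
`Δ₀ > 0`; conclusion (RM) on all families of all odd tori for `β ≥ β₁'` with `B = A₀ + max(B_Q, 2e²·1536·(Δ₀ + D))`. [folklore] -/
theorem responseMoments_of_quadratic_and_windowCellLaws_floor (a : ℝ → ℝ) (𝔟 : BlockSize) (ε : ℝ → ℕ → ℝ) (kmax : ℝ → ℕ → ℕ)
    {C₁ β₁ ℓ₁ A₀ B_Q D Δ₀ ε₀ : ℝ} {p : Fin 4 × Fin 4 → ℝ → ℝ} (hε₀ : 0 < ε₀) (hε : ∀ β, ε₀ ≤ ε β 0) (hΔ₀ : 0 < Δ₀)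
    (Q : ℝ → ℕ → Fin 4 × Fin 4 → (Fin 4 → ℤ) → LGConfig 4 (Matrix.specialUnitaryGroup (Fin N) ℂ) → ℝ)
    (MQ : ℝ → ℕ → Fin 4 × Fin 4 → (Fin 4 → ℤ) → ℝ)
    (hQm : ∀ β R q x, Measurable (Q β R q x)) (hQb : ∀ β R q x η, |Q β R q x η| ≤ MQ β R q x)
    (hsplit : ∀ β : ℝ, β₁ ≤ β → ∀ R : ℕ, 1 ≤ R → (R : ℝ) * a β ≤ ℓ₁ →
      ∀ (q : Fin 4 × Fin 4) (x : Fin 4 → ℤ), q.1 < q.2 → ∀ η : LGConfig 4 (Matrix.specialUnitaryGroup (Fin N) ℂ),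
        (R : ℝ) ^ 4 / C₁ * |kerE (Matrix.specialUnitaryGroup (Fin N) ℂ) (fundamentalLatticeRep N) β (fun k => x k - (R + 1))
          (2 * R + 3) η (plane (Matrix.specialUnitaryGroup (Fin N) ℂ) (fundamentalLatticeRep N) q x) - p q β| ≤
          A₀ + Q β R q x η + influenceAt (N := N) 𝔟 ε kmax β R q x η)
    (hEMQ : ∀ β : ℝ, β₁ ≤ β → ∀ (L n : ℕ) (q : Fin n → Fin 4 × Fin 4) (x : Fin n → (Fin 4 → ℤ)) (R : ℕ),
      (∀ i, (q i).1 < (q i).2) → 1 ≤ R → (R : ℝ) * a β ≤ ℓ₁ → 4 * R + 8 ≤ L →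
      (∀ i j : Fin n, i ≠ j → ∃ k : Fin 4,
        (2 * (R : ℤ) + 4) ≤ |((((x i k - x j k : ℤ) : ZMod (2 * L + 1))).valMinAbs : ℤ)|) →
      ∀ T : Finset (Fin n),
        torusE (Matrix.specialUnitaryGroup (Fin N) ℂ) (fundamentalLatticeRep N) β L
          (fun U => Real.exp (((2 : ℕ) : ℝ) * ∑ i ∈ T, Q β R (q i) (x i) U)) ≤ Real.exp (B_Q * T.card))
    (θ δ : ℝ → ℕ → ℝ) (hθ0 : ∀ β k, 0 ≤ θ β k) (hθ1 : ∀ β k, θ β k ≤ 1) (hδ0 : ∀ β k, 0 ≤ δ β k)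
    (hδθ : ∀ β k, δ β k ≤ θ β k ^ 16)
    (hWCL : ∀ β : ℝ, β₁ ≤ β → ∀ L : ℕ, 1 ≤ L → ∀ k : ℕ, 1 ≤ k → ∀ (o : Fin 4 → ℤ) (A : Finset Polymer),
      (∀ γ ∈ A, γ.k = k) → (∀ γ ∈ A, ∀ c, o c ≤ anchor 𝔟 γ c ∧ anchor 𝔟 γ c + (𝔟.b : ℤ) ^ k ≤ o c + (2 * L + 1)) →
      torusE (Matrix.specialUnitaryGroup (Fin N) ℂ) (fundamentalLatticeRep N) β L (fun U => ∏ γ ∈ A,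
        (largeFieldEvent (N := N) 𝔟 (ε β k) γ).indicator (fun _ => (1 : ℝ)) U) ≤ ∏ _γ ∈ A, δ β k)
    (hD : ∀ β : ℝ, β₁ ≤ β → ∀ R : ℕ, ∑ k ∈ (Finset.range (kmax β R + 1)).filter (fun k => 1 ≤ k), θ β k ≤ D) :
    ∃ β₁' : ℝ, ∀ β : ℝ, β₁' ≤ β → ∀ (L n : ℕ) (q : Fin n → Fin 4 × Fin 4) (x : Fin n → (Fin 4 → ℤ)) (R : ℕ),
      (∀ i, (q i).1 < (q i).2) → 1 ≤ R → (R : ℝ) * a β ≤ ℓ₁ → 4 * R + 8 ≤ L →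
      (∀ i j : Fin n, i ≠ j → ∃ k : Fin 4,
        (2 * (R : ℤ) + 4) ≤ |((((x i k - x j k : ℤ) : ZMod (2 * L + 1))).valMinAbs : ℤ)|) →
      ∀ T : Finset (Fin n),
        torusE (Matrix.specialUnitaryGroup (Fin N) ℂ) (fundamentalLatticeRep N) β L (fun U => Real.exp (∑ i ∈ T, (R : ℝ) ^ 4 / C₁ *
          |kerE (Matrix.specialUnitaryGroup (Fin N) ℂ) (fundamentalLatticeRep N) β (fun k => x i k - (R + 1)) (2 * R + 3) U
            (plane (Matrix.specialUnitaryGroup (Fin N) ℂ) (fundamentalLatticeRep N) (q i) (x i)) - p (q i) β|)) ≤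
          Real.exp ((A₀ + max B_Q (2 * Real.exp (2 * 1) * (1536 * (Δ₀ + D)))) * T.card) :=
  responseMoments_of_quadratic_and_windowCellLaws (N := N) a 𝔟 ε kmax Q MQ hQm hQb hsplit hEMQ
    (fun K₀ D₁ => levelZero_activity_eventually_le (Nat.pos_of_ne_zero (NeZero.ne N)) hε₀ hΔ₀ ε hε K₀ D₁)
    θ δ hθ0 hθ1 hδ0 hδθ hWCL hD

end Floor

/-! ## §3 At the registered stub (SU(2), fundamental representation, unit of record) -/

section Unit

/-- **The body of `stub_responseMomentsOdd6` from the (β) split, (EM_Q), a level-`0` threshold floor and WINDOW CELL LAWS at the levels `k ≥ 1`.**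
`SU(2)`, fundamental representation, unit `a ≤ c·uRec` eventually; `0 < ε₀ ≤ ε(β,0)`, any `Δ₀ > 0`; conclusion = the registered body with
`B = A₀ + max(B_Q, 2e²·1536·(Δ₀ + D))`.  THE LANE-B RESIDUAL OF (S-A) ALONG (β), BY NAME: `hWCL` + `hD`. [folklore] -/
theorem responseMomentsOdd6_of_quadratic_and_windowCellLaws_floor {a : ℝ → ℝ} {c C₁ β₁ ℓ₁ A₀ B_Q D Δ₀ ε₀ P₀ : ℝ}
    {p : Fin 4 × Fin 4 → ℝ → ℝ} (hc : 0 < c) (hle : ∀ᶠ β in atTop, a β ≤ c * Transport.uRec β) (hℓ₁ : 0 < ℓ₁)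
    (hC₁ : 0 < C₁) (hp : ∀ q β, |p q β| ≤ P₀) (𝔟 : BlockSize) (ε : ℝ → ℕ → ℝ) (kmax : ℝ → ℕ → ℕ)
    (hε₀ : 0 < ε₀) (hε : ∀ β, ε₀ ≤ ε β 0) (hΔ₀ : 0 < Δ₀)
    (Q : ℝ → ℕ → Fin 4 × Fin 4 → (Fin 4 → ℤ) → LGConfig 4 (Matrix.specialUnitaryGroup (Fin 2) ℂ) → ℝ)
    (MQ : ℝ → ℕ → Fin 4 × Fin 4 → (Fin 4 → ℤ) → ℝ)
    (hQm : ∀ β R q x, Measurable (Q β R q x)) (hQb : ∀ β R q x η, |Q β R q x η| ≤ MQ β R q x)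
    (hsplit : ∀ β : ℝ, β₁ ≤ β → ∀ R : ℕ, 1 ≤ R → (R : ℝ) * a β ≤ ℓ₁ →
      ∀ (q : Fin 4 × Fin 4) (x : Fin 4 → ℤ), q.1 < q.2 → ∀ η : LGConfig 4 (Matrix.specialUnitaryGroup (Fin 2) ℂ),
        (R : ℝ) ^ 4 / C₁ * |kerE (Matrix.specialUnitaryGroup (Fin 2) ℂ) (fundamentalLatticeRep 2) β (fun k => x k - (R + 1))
          (2 * R + 3) η (plane (Matrix.specialUnitaryGroup (Fin 2) ℂ) (fundamentalLatticeRep 2) q x) - p q β| ≤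
          A₀ + Q β R q x η + influenceAt (N := 2) 𝔟 ε kmax β R q x η)
    (hEMQ : ∀ β : ℝ, β₁ ≤ β → ∀ (L n : ℕ) (q : Fin n → Fin 4 × Fin 4) (x : Fin n → (Fin 4 → ℤ)) (R : ℕ),
      (∀ i, (q i).1 < (q i).2) → 1 ≤ R → (R : ℝ) * a β ≤ ℓ₁ → 4 * R + 8 ≤ L →
      (∀ i j : Fin n, i ≠ j → ∃ k : Fin 4,
        (2 * (R : ℤ) + 4) ≤ |((((x i k - x j k : ℤ) : ZMod (2 * L + 1))).valMinAbs : ℤ)|) →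
      ∀ T : Finset (Fin n),
        torusE (Matrix.specialUnitaryGroup (Fin 2) ℂ) (fundamentalLatticeRep 2) β L
          (fun U => Real.exp (((2 : ℕ) : ℝ) * ∑ i ∈ T, Q β R (q i) (x i) U)) ≤ Real.exp (B_Q * T.card))
    (θ δ : ℝ → ℕ → ℝ) (hθ0 : ∀ β k, 0 ≤ θ β k) (hθ1 : ∀ β k, θ β k ≤ 1) (hδ0 : ∀ β k, 0 ≤ δ β k)
    (hδθ : ∀ β k, δ β k ≤ θ β k ^ 16)
    (hWCL : ∀ β : ℝ, β₁ ≤ β → ∀ L : ℕ, 1 ≤ L → ∀ k : ℕ, 1 ≤ k → ∀ (o : Fin 4 → ℤ) (A : Finset Polymer),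
      (∀ γ ∈ A, γ.k = k) → (∀ γ ∈ A, ∀ c, o c ≤ anchor 𝔟 γ c ∧ anchor 𝔟 γ c + (𝔟.b : ℤ) ^ k ≤ o c + (2 * L + 1)) →
      torusE (Matrix.specialUnitaryGroup (Fin 2) ℂ) (fundamentalLatticeRep 2) β L (fun U => ∏ γ ∈ A,
        (largeFieldEvent (N := 2) 𝔟 (ε β k) γ).indicator (fun _ => (1 : ℝ)) U) ≤ ∏ _γ ∈ A, δ β k)
    (hD : ∀ β : ℝ, β₁ ≤ β → ∀ R : ℕ, ∑ k ∈ (Finset.range (kmax β R + 1)).filter (fun k => 1 ≤ k), θ β k ≤ D) :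
    ∃ (a : ℝ → ℝ) (c : ℝ) (C₁ B β₁ ℓ₁ P₀ : ℝ) (p : Fin 4 × Fin 4 → ℝ → ℝ), 0 < c ∧
      (∀ᶠ β in atTop, a β ≤ c * Transport.uRec β) ∧ 0 < ℓ₁ ∧ 0 < C₁ ∧ (∀ q β, |p q β| ≤ P₀) ∧
      ∀ β : ℝ, β₁ ≤ β → ∀ (L n : ℕ) (q : Fin n → Fin 4 × Fin 4) (x : Fin n → (Fin 4 → ℤ)) (R : ℕ),
        (∀ i, (q i).1 < (q i).2) → 1 ≤ R → (R : ℝ) * a β ≤ ℓ₁ → 4 * R + 8 ≤ L →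
        (∀ i j : Fin n, i ≠ j → ∃ k : Fin 4,
          (2 * (R : ℤ) + 4) ≤ |((((x i k - x j k : ℤ) : ZMod (2 * L + 1))).valMinAbs : ℤ)|) →
        ∀ T : Finset (Fin n),
          torusE (Matrix.specialUnitaryGroup (Fin 2) ℂ) (fundamentalLatticeRep 2) β L
            (fun U => Real.exp (∑ i ∈ T, (R : ℝ) ^ 4 / C₁ *
              |kerE (Matrix.specialUnitaryGroup (Fin 2) ℂ) (fundamentalLatticeRep 2) β (fun k => x i k - (R + 1)) (2 * R + 3) U
                (plane (Matrix.specialUnitaryGroup (Fin 2) ℂ) (fundamentalLatticeRep 2) (q i) (x i)) - p (q i) β|)) ≤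
            Real.exp (B * T.card) := by
  obtain ⟨β₁', h⟩ := responseMoments_of_quadratic_and_windowCellLaws_floor (N := 2) a 𝔟 ε kmax hε₀ hε hΔ₀ Q MQ hQm hQb hsplit
    hEMQ θ δ hθ0 hθ1 hδ0 hδθ hWCL hD
  exact ⟨a, c, C₁, A₀ + max B_Q (2 * Real.exp (2 * 1) * (1536 * (Δ₀ + D))), β₁', ℓ₁, P₀, p, hc, hle, hℓ₁, hC₁, hp, h⟩

end Unit

end Summit.QuantumFields.YangMills.Cruxes.UVSeamRec.TemperedResponse

end
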